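import Summits.Ventures.HodgeRepro.Groups
import Summits.Ventures.HodgeRepro.Faces
import Summits.Ventures.HodgeRepro.RouteCReflexModel
import Summits.Ventures.HodgeRepro.RouteCCosetModel

/-!
# The first open degree-8 rank-four face, read for closer C5′ (Route C): corner classes, reduced
product, Liu types and the codimension range — all on the finite-group model

Blind re-derivation cell `pub-hodge-repro`, seat `night-1`.  The face is the FIRST representative of the
first order-8 row of the sealed census (`FaceCensusRows8.lean`, namespace `Octic.Cyclic`: `G = ℤ/8`,
`c = σ⁴`, `reps = [(15, 17, 34), …]`): the bitmask `15 = {σ⁰, σ¹, σ², σ³}` is the CM type `Φ₀`, the masks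
`17 = {σ⁰, σ⁴}` and `34 = {σ¹, σ⁵}` are the places of `σ⁰` and of `σ¹`.  In typer's model
(`Groups.lean`: `C8 = Multiplicative (ZMod 8)`, `cc_C8 = ofAdd 4`) the face is
`faceCorners cc_C8 Φ₀ (ofAdd 0) (ofAdd 1)` with corners

* `T 0 = Φ₀ = {0, 1, 2, 3}`,
* `T 1 = (Φ̄₀)^{(π)} = {0, 5, 6, 7} = Φ₀ · σ⁵` (a Galois twist of `Φ₀`),
* `T 2 = (Φ̄₀)^{(π′)} = {1, 4, 6, 7} =: Φ₁` (primitive, NOT a twist of `Φ₀`),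
* `T 3 = Φ₀^{(ππ′)} = {2, 3, 4, 5} = Φ₀ · σ²` (a Galois twist of `Φ₀`)

(exponents of `σ`, i.e. `ofAdd i`).  So the corner product `B = ∏_i A_{T i}` sorts into TWO isogeny
classes with representatives `Φ₀`, `Φ₁` (`reps`), class map `cls = ![0, 0, 1, 0]` and twists
`tw = ![1, σ⁵, 1, σ²]` (`face_eq_corner`), both representatives primitive (`isPrimitive_reps`: the
simple factors `A₀ = A_{Φ₀}`, `A₁ = A_{Φ₁}` have CM by the whole octic field, dimension `4` each), so
`B ≅ A₀³ × A₁` and `B_red = A₀ × A₁` is an eightfold — ROUTE.md §3.3's «C8: 3 classes, B_red = A₁ × A₂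
(4+4, two non-isogenous simple CM fourfolds)», here for its first class.

What this file proves on the model (every statement a `decide` or an instance of a landed theorem):

1. the face data (`face_eq_corner`, `isCMType_reps`, `isPrimitive_reps`, `reps_ne_twist`,
   `cls_tw_injective`, `sumTwo_face`, `face_noConjugateCorners`, `face_corners_distinct`);
2. **Lemma R, combinatorial core** (typer `FaceReduce.isHodgeSetProd_reducedSet`): for every embedding
   `s`, the reduced set `U_s = {(cls i, s · (tw i)⁻¹)} ⊆ Fin 2 × C8` has `4` elements and satisfies
   Pohlmann's product criterion for `(Φ₀, Φ₁)` — the `s`-line of the Weil class `W_F(B)` is, on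
   `B_red = A₀ × A₁`, the codimension-2 Hodge line of the Pohlmann set `U_s`
   (`isHodgeSetProd_reducedSet_face`, `card_reducedSet_face`);
3. **the Liu types** (R3/R4 of Route C): `liuType Φ₀ = {0, 5, 6, 7} = Φ₀ · σ⁵` and
   `liuType Φ₁ = {1, 2, 4, 7}`, both CM types of `(C8, σ⁴)` with reflex stabiliser `⊥`
   (`reflexStab_liuType_reps`): in the model, `reflex(E, liuType Φ_k) = (E, Φ_k)` — the CM type of `E`
   that Liu Cor 4.20 / Def 4.5 attach to a character `μ_k` with `Φ_{μ_k} = liuType Φ_k` is exactly the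
   type of the simple factor `A_k` (Shimura §8.3, «reflex of the reflex»);
4. **the numbers of the closer**: `[E⁺ : ℚ] = 4 ≥ 2` (R0), `g = dim B_red = 8`, `k = 2`,
   `p = max(3k, g) = 8`, `n = p + 1 = 9 ≥ 3` (Liu's Compact Case with `n ≥ 3`), and BMM Cor 2's range
   `k ∈ [0, p] ∖ ]p/3, 2p/3[` at `(p, k) = (8, 2)` (`bmm_range_face`).

The discharge itself — the face's Weil line is algebraic GIVEN the printed clauses — is the theorem
`RouteCClauses.lean` proves from these data; nothing here says anything about the status of the Hodge
conjecture for CM abelian varieties, which is NOT proved.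
-/

open Finset
open scoped Pointwise

namespace HodgeRepro.RouteC

namespace FaceC8

/-- `σ^i ∈ C8` (`ofAdd i`). -/
abbrev σ (i : ZMod 8) : C8 := Multiplicative.ofAdd i

/-- The CM type `Φ₀ = {σ⁰, σ¹, σ², σ³}` (sealed bitmask `15`). -/
def Φ₀ : Finset C8 := {σ 0, σ 1, σ 2, σ 3}

/-- The CM type `Φ₁ = {σ¹, σ⁴, σ⁶, σ⁷}` — the corner `(Φ̄₀)^{(π′)}`, primitive and not a twist of `Φ₀`. -/
def Φ₁ : Finset C8 := {σ 1, σ 4, σ 6, σ 7}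

/-- The place `π` of `σ⁰` (sealed mask `17 = {σ⁰, σ⁴}`). -/
def π : C8 := σ 0

/-- The place `π′` of `σ¹` (sealed mask `34 = {σ¹, σ⁵}`). -/
def π' : C8 := σ 1

/-- The face `(Φ₀; π, π′)` of the sealed representative `(15, 17, 34)`. -/
def face : Fin 4 → Finset C8 := faceCorners cc_C8 Φ₀ π π'

/-- The two isogeny-class representatives `Φ₀`, `Φ₁`. -/
def reps : Fin 2 → Finset C8 := ![Φ₀, Φ₁]

/-- The class of each corner: corners `0, 1, 3` are twists of `Φ₀`, corner `2` is `Φ₁`. -/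
def cls : Fin 4 → Fin 2 := ![0, 0, 1, 0]

/-- The twists: `T 0 = Φ₀`, `T 1 = Φ₀ · σ⁵`, `T 2 = Φ₁`, `T 3 = Φ₀ · σ²`. -/
def tw : Fin 4 → C8 := ![1, σ 5, 1, σ 2]

/-- `Φ₀` is a CM type of `(C8, σ⁴)`. -/
theorem isCMType_Φ₀ : IsCMType cc_C8 Φ₀ := by decide

/-- `Φ₁` is a CM type of `(C8, σ⁴)`. -/
theorem isCMType_Φ₁ : IsCMType cc_C8 Φ₁ := by decide

/-- Both representatives are CM types. -/
theorem isCMType_reps : ∀ k, IsCMType cc_C8 (reps k) := by decide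

/-- `π′ ∉ {π, c π}`: the two places are distinct. -/
theorem π'_not_mem_place : π' ∉ place cc_C8 π := by decide

/-- **The corners sorted into classes and twists**: `faceCorners cc_C8 Φ₀ π π′ = corner reps cls tw`,
i.e. `T i = reps (cls i) · tw i` for every corner. -/
theorem face_eq_corner : face = corner reps cls tw := by
  decide

/-- The corners, explicitly. -/
theorem face_corners :
    face = ![Φ₀, {σ 0, σ 5, σ 6, σ 7}, Φ₁, {σ 2, σ 3, σ 4, σ 5}] := by
  decide

/-- Both representatives are PRIMITIVE: the simple factors `A₀`, `A₁` have CM by the whole octic field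
(their right stabilisers are trivial). -/
theorem isPrimitive_reps : ∀ k, IsPrimitive (reps k) := by decide

/-- `rstab Φ₀ = ⊥` and `rstab Φ₁ = ⊥`. -/
theorem rstab_reps : ∀ k, rstab (reps k) = ⊥ := fun k =>
  (isPrimitive_iff_rstab_eq_bot _).1 (isPrimitive_reps k)

/-- `Φ₁` is NOT a Galois twist of `Φ₀`: the two classes are distinct (two non-isogenous simple CM
fourfolds, ROUTE.md §3.3 «C8: … 4+4»). -/
theorem reps_ne_twist : ∀ g : C8, rmul Φ₀ g ≠ Φ₁ := by decide

/-- The pairs `(class, twist)` of the four corners are pairwise distinct — the injectivity hypothesis of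
Lemma R (`S3ᴿ`, ROUTE.md §1: «within each class the twists are pairwise distinct»). -/
theorem cls_tw_injective : Function.Injective fun i => (cls i, tw i) := by decide

/-- `SumTwo`: every embedding lies in exactly two corners (instance of typer's `sumTwo_faceCorners`). -/
theorem sumTwo_face : SumTwo face :=
  sumTwo_faceCorners cc_C8_isComplexConj isCMType_Φ₀ π'_not_mem_place

/-- No two corners are complex-conjugate types (the sealed `noConjugateCorners`). -/
theorem face_noConjugateCorners : ∀ i j, face j ≠ cc_C8 • face i := by decide

/-- The four corners are pairwise distinct CM types (the sealed `cornersWF`). -/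
theorem face_corners_distinct : Function.Injective face := by decide

/-! ### Lemma R, combinatorial core, on this face -/

/-- **Lemma R on the face** (typer `isHodgeSetProd_reducedSet`): for every embedding `s`, the reduced set
`U_s = {(cls i, s · (tw i)⁻¹) : i}` satisfies Pohlmann's product criterion for `(Φ₀, Φ₁)` — the `s`-line
of the Weil class of `B` is the Hodge line of `U_s` on `B_red = A₀ × A₁`. -/
theorem isHodgeSetProd_reducedSet_face (s : C8) :
    IsHodgeSetProd cc_C8 reps (reducedSet cls tw s) :=
  isHodgeSetProd_reducedSet cc_C8_isComplexConj reps cls tw cls_tw_injective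
    (face_eq_corner ▸ sumTwo_face) s

/-- The reduced set has `4` elements (codimension `2` on `B_red`). -/
theorem card_reducedSet_face (s : C8) : (reducedSet cls tw s).card = 4 := by
  rw [card_reducedSet cls tw cls_tw_injective s, Fintype.card_fin]

/-! ### The Liu types of the two classes (R3/R4) -/

/-- `liuType Φ₀ = {σ⁰, σ⁵, σ⁶, σ⁷}` (which happens to be the corner `T 1 = Φ₀ · σ⁵`). -/
theorem liuType_Φ₀ : liuType Φ₀ = {σ 0, σ 5, σ 6, σ 7} := by decide

/-- `liuType Φ₁ = {σ¹, σ², σ⁴, σ⁷}`. -/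
theorem liuType_Φ₁ : liuType Φ₁ = {σ 1, σ 2, σ 4, σ 7} := by decide

/-- Both Liu types are CM types of `(C8, σ⁴)` — the types `Φ_μ` for which DR Lemma 3.5 supplies a
conjugate-symplectic weight-one character `μ`. -/
theorem isCMType_liuType_reps : ∀ k, IsCMType cc_C8 (liuType (reps k)) := fun k =>
  isCMType_liuType cc_C8_isComplexConj (isCMType_reps k)

/-- The reflex field of `(E, liuType Φ_k)` is `E` itself (`Stab = ⊥`): Liu's `M'_μ = E` and the reflex
type of `(E, Φ_μ)` is `Φ_k` — `A_μ` is isogenous to a power of the simple factor `A_k` (Shimura §8.3). -/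
theorem reflexStab_liuType_reps : ∀ k, Hecke.reflexStab (liuType (reps k)) = ⊥ := fun k =>
  reflexStab_liuType_eq_bot_of_isPrimitive (isPrimitive_reps k)

/-- The reflex of the reflex is the corner: `liuType (liuType (reps k)) = reps k`. -/
theorem liuType_liuType_reps : ∀ k, liuType (liuType (reps k)) = reps k := fun k =>
  liuType_liuType (reps k)

/-! ### The numbers of the closer on this face -/

/-- `|G| = 8`, so `[E⁺ : ℚ] = 4`. -/
theorem card_G : Fintype.card C8 = 8 := card_C8

/-- Each simple factor has dimension `|G| / (2 · |rstab|) = 4`. -/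
theorem dim_simple : ∀ k, Nat.card C8 / (2 * Nat.card (rstab (reps k))) = 4 := by
  intro k
  rw [rstab_reps k, Subgroup.card_bot, Nat.card_eq_fintype_card, card_G]

/-- `g = dim B_red = Σ_k |G| / (2 |rstab (reps k)|) = 4 + 4 = 8`. -/
theorem sum_dim_simple : (∑ k, Nat.card C8 / (2 * Nat.card (rstab (reps k)))) = 8 := by
  rw [Finset.sum_congr rfl fun k _ => dim_simple k]
  simp

/-- The coset map of the reduced product is injective (both representatives primitive): `B_red`'s
embedding `G`-set is `Fin 2 × C8` itself. -/
theorem cosetMap_injective : Function.Injective (cosetMap reps) :=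
  cosetMap_injective_of_isPrimitive isPrimitive_reps

/-- The reduced sets embed in the coset `G`-set (Lemma R's injectivity hypothesis on the algebra side). -/
theorem injOn_cosetMap_reducedSet (s : C8) : Set.InjOn (cosetMap reps) (reducedSet cls tw s) :=
  cosetMap_injective.injOn

/-- **Lemma R on the CM-algebra side, on this face**: the image of every reduced set is a Pohlmann set of
the type of `B_red = A₀ × A₁` on its coset `G`-set. -/
theorem isHodgeSetOn_cosetMap_reducedSet_face (s : C8) :
    IsHodgeSetOn cc_C8 (cosetType reps) ((reducedSet cls tw s).image (cosetMap reps)) :=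
  isHodgeSetOn_cosetMap_reducedSet cc_C8_isComplexConj reps cls tw cls_tw_injective
    (face_eq_corner ▸ sumTwo_face) s (injOn_cosetMap_reducedSet s)

/-- `g = dim B_red = 4 + 4 = 8`. -/
def dimBred : ℕ := 8

/-- The codimension of the Weil class: `k = 2`. -/
def codim : ℕ := 2

/-- Route C's `p = max (3k, g) = 8`. -/
def p : ℕ := max (3 * codim) dimBred

/-- `p = 8`. -/
theorem p_eq : p = 8 := by decide

/-- `[E⁺ : ℚ] = 4 ≥ 2` (R0: `E⁺ ≠ ℚ`, so the Hermitian space is anisotropic and the Shimura variety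
compact). -/
theorem two_le_half_card : 2 ≤ Fintype.card C8 / 2 := by decide

/-- Liu's `n = p + 1 = 9 ≥ 3`. -/
theorem three_le_n : 3 ≤ p + 1 := by decide

/-- `g ≤ p`: the ball quotient has dimension at least `dim B_red` (R5, dominance). -/
theorem dimBred_le_p : dimBred ≤ p := by decide

/-- **BMM Cor 2's range** at `(p, k) = (8, 2)`: `k ≤ p` and `k ∉ ]p/3, 2p/3[`, i.e. `¬ (p < 3k ∧ 3k < 2p)`
— here `3k = 6 ≤ 8 = p`. -/
theorem bmm_range_face : codim ≤ p ∧ ¬ (p < 3 * codim ∧ 3 * codim < 2 * p) := by decide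

end FaceC8

end HodgeRepro.RouteC
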